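import Summits.HodgeConjecture.CorCM.Census.OcticWeil13Pair
import HarnessLib

/-!
# Two `(1,3)`-types over one octic CM field — the generating parts of a balanced configuration (pairs, Weil parts of the
# `(2,2)`-slot, SIXFOLD parts of either `(1,3)`-slot, the EIGHTFOLD part), extraction, and the induction principle

COR-CM (cell `pub-hodgecm2`), seat b30 gen 21 (2026-08-22); count-neutral own lane OCTIC-WEIL-EIGHTFOLD, sequel of
`Census/OcticWeil13Pair.lean` (DEFECT LAW `exists_defectP_of_modelBalancedP`: `d_m` constant in `a`, `e = 2t_1 + 2t_2`).
Bookkeeping definitions and theorems of the finite model; no named fact, no geometry, no `sorry`.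
* `IsSixfoldPart v m b G` — two points over `inl b` and one over each `(m, a, b)`: a lift of the Weil weight of the SIXFOLD
  `B'_m × E × E` (slot-parametric form of `Census/OcticWeilMixedParts`' `IsSix₃Part`);
* **`IsEightfoldPart v b G`** — one point over each `(1, a, b)` and each `(2, a, ¬b)`: a lift of the Weil weight of the
  EIGHTFOLD `B'₁ × B̄'₂` (`k`-signature `(4,4)`); `e`-FREE, hence not a union of sixfold parts inside a configuration without
  curve points (downstream: push-pull through `X × E⁴`, `CorCM/CMWeightPushforwardExtraction`); `exists_split`: it is the
  disjoint union of Weil `4`-sets of slots `1` and `2`;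
* the parts are balanced; **`exists_part_of_modelBalancedP`** (EXTRACTION: `t_0 ≠ 0` ⟹ Weil part; `t_1`, `t_2` of strictly
  opposite signs ⟹ eightfold part; some `t_m ≠ 0`, `m = 1, 2` ⟹ the curve carries `|e| = 2|t_1 + t_2| ≥ 2` points of that
  sign ⟹ sixfold part; else a pair part); **`modelBalancedP_induction`** (any number of copies of `E, B, B'₁, B'₂`).
[cite: Pohlmann1968, Thm 1] [cite: GaoUllmo2025, Thm 3.1] [cite: Milne2020HodgeClassesAV, 1.2 (a) and Thm. 1]
[cite: MoonenZarhin1995Duke, Thm. 2.4] [cite: Gordon1999HodgeAVSurvey, 5.13 (ii), 9.2.2]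

## References
* [Pohlmann1968] Ann. of Math. 88 (1968), Thm 1.  [GaoUllmo2025] J. Inst. Math. Jussieu 25 (2025), Thm 3.1.
  [Milne2020HodgeClassesAV] arXiv:2010.08857, 1.2 (a), Thm. 1.  [MoonenZarhin1995Duke] Duke Math. J. 77 (1995), Thm. 2.4.
  [Gordon1999HodgeAVSurvey] CRM Monogr. 10 (1999), 5.13 (ii), 9.2.2.
-/

namespace Summit.HodgeConjecture.CorCM.Census.OcticWeil13Pair

open Finset
open Summit.HodgeConjecture.CorCM.Census.OcticWeilOrbit (Pt₃ cj₃ cj₃_inl cj₃_inr cj₃_facts permTab signTab IsPairPart₃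
  IsWeil₃Part card_filter_mem_eq_sum₃ card_eq_sum₃ sum_pt₃ exists_weil₃Part_of_counts exists_pairPart₃_of_counts)
open Summit.HodgeConjecture.CorCM.Census.OcticWeilMixed (sixTab sixTab_eq)

variable {α : Type*} {v : α → Pt₃}

/-! ### The sixfold and eightfold parts -/

/-- **A Weil SIXFOLD part of slot `m` and sign `b`**: six points, two over the curve label `inl b` and one over each
`(m, a, b)` — a lift of the Weil weight `2[τ_b] + Σ_{s over τ_b} [s]` of `B'_m × E × E` (`k`-signature `(3,3)`).
[cite: MoonenZarhin1995Duke, Thm. 2.4] [cite: Gordon1999HodgeAVSurvey, 5.13 (ii)] -/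
def IsSixfoldPart (v : α → Pt₃) (m : Fin 3) (b : Bool) (G : Finset α) : Prop :=
  G.card = 6 ∧ (G.filter fun x => v x = Sum.inl b).card = 2 ∧ ∀ a : Fin 4, (G.filter fun x => v x = Sum.inr (m, (a, b))).card = 1

/-- **The Weil EIGHTFOLD part of sign `b`**: eight points, one over each `(1, a, b)` and one over each `(2, a, ¬b)` — a lift of
the Weil weight of the eightfold `B'₁ × B̄'₂` (`k` acting through `ι₁ × ι₂ ∘ conj`, signature `(4,4)`).
[cite: MoonenZarhin1995Duke, Thm. 2.4] [cite: Gordon1999HodgeAVSurvey, 5.13 (ii)] -/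
def IsEightfoldPart (v : α → Pt₃) (b : Bool) (G : Finset α) : Prop :=
  G.card = 8 ∧ (∀ a : Fin 4, (G.filter fun x => v x = Sum.inr (1, (a, b))).card = 1) ∧
    ∀ a : Fin 4, (G.filter fun x => v x = Sum.inr (2, (a, !b))).card = 1

/-- The count function of a sixfold part: `2` on `inl b`, `1` on the four `(m, a, b)`, `0` elsewhere. [folklore] -/
theorem IsSixfoldPart.count_eq {m : Fin 3} {b : Bool} {G : Finset α} (hG : IsSixfoldPart v m b G) (z : Pt₃) :
    (G.filter fun x => v x = z).card =
      if z = Sum.inl b then 2 else if ∃ a : Fin 4, z = Sum.inr (m, (a, b)) then 1 else 0 := by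
  classical
  obtain ⟨hcard, hE, hB⟩ := hG
  split_ifs with hz hz'
  · rw [hz]; exact hE
  · obtain ⟨a, rfl⟩ := hz'; exact hB a
  · push Not at hz'
    have hle : (G.filter fun x => v x = Sum.inl b).card + ∑ a : Fin 4, (G.filter fun x => v x = Sum.inr (m, (a, b))).card +
        (G.filter fun x => v x = z).card ≤ G.card := by
      have hpd : ∀ a ∈ (univ : Finset (Fin 4)), ∀ a' ∈ (univ : Finset (Fin 4)), a ≠ a' →
          Disjoint (G.filter fun x => v x = Sum.inr (m, (a, b))) (G.filter fun x => v x = Sum.inr (m, (a', b))) :=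
        fun a _ a' _ haa => Finset.disjoint_filter.2 fun x _ h1 h2 => haa (by
          have := h1.symm.trans h2; simpa using this)
      have hd1 : Disjoint (G.filter fun x => v x = Sum.inl b)
          ((univ : Finset (Fin 4)).biUnion fun a => G.filter fun x => v x = Sum.inr (m, (a, b))) :=
        (Finset.disjoint_biUnion_right _ _ _).2 fun a _ => Finset.disjoint_filter.2 fun x _ h1 h2 => by
          rw [h1] at h2; exact Sum.inl_ne_inr h2
      have hd2 : Disjoint ((G.filter fun x => v x = Sum.inl b) ∪
          (univ : Finset (Fin 4)).biUnion fun a => G.filter fun x => v x = Sum.inr (m, (a, b))) (G.filter fun x => v x = z) := by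
        rw [Finset.disjoint_union_left]
        refine ⟨Finset.disjoint_filter.2 fun x _ h1 h2 => hz (h2.symm.trans h1), ?_⟩
        exact (Finset.disjoint_biUnion_left _ _ _).2 fun a _ => Finset.disjoint_filter.2 fun x _ h1 h2 => hz' a (h2.symm.trans h1)
      rw [← Finset.card_biUnion hpd, ← Finset.card_union_of_disjoint hd1, ← Finset.card_union_of_disjoint hd2]
      exact Finset.card_le_card (Finset.union_subset (Finset.union_subset (Finset.filter_subset _ _)
        (Finset.biUnion_subset.2 fun a _ => Finset.filter_subset _ _)) (Finset.filter_subset _ _))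
    simp only [hE, hB, Finset.sum_const, Finset.card_univ, Fintype.card_fin, smul_eq_mul, mul_one, hcard] at hle
    omega

/-- The two halves of an eightfold part are Weil parts of slots `1` (sign `b`) and `2` (sign `¬b`). [folklore] -/
theorem IsEightfoldPart.exists_split [DecidableEq α] {b : Bool} {G : Finset α} (hG : IsEightfoldPart v b G) :
    ∃ G₁ G₂ : Finset α, Disjoint G₁ G₂ ∧ G = G₁ ∪ G₂ ∧ IsWeil₃Part v 1 b G₁ ∧ IsWeil₃Part v 2 (!b) G₂ := by
  obtain ⟨W₁, hW₁, hW₁'⟩ := exists_weil₃Part_of_counts (v := v) (T := G) 1 b fun a => by rw [hG.2.1 a]; exact one_pos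
  obtain ⟨W₂, hW₂, hW₂'⟩ := exists_weil₃Part_of_counts (v := v) (T := G) 2 (!b) fun a => by rw [hG.2.2 a]; exact one_pos
  have hW : Disjoint W₁ W₂ := by
    rw [Finset.disjoint_left]
    intro x hx1 hx2
    obtain ⟨a, ha⟩ := hW₁'.exists_eq_inr hx1
    obtain ⟨a', ha'⟩ := hW₂'.exists_eq_inr hx2
    have := ha.symm.trans ha'
    simp at this
  refine ⟨W₁, W₂, hW, ?_, hW₁', hW₂'⟩
  symm
  apply Finset.eq_of_subset_of_card_le (Finset.union_subset hW₁ hW₂)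
  rw [Finset.card_union_of_disjoint hW, hW₁'.1, hW₂'.1, hG.1]

/-- The count function of an eightfold part: `1` on the four `(1, a, b)` and the four `(2, a, ¬b)`, `0` elsewhere. [folklore] -/
theorem IsEightfoldPart.count_eq [DecidableEq α] {b : Bool} {G : Finset α} (hG : IsEightfoldPart v b G) (z : Pt₃) :
    (G.filter fun x => v x = z).card =
      if (∃ a : Fin 4, z = Sum.inr (1, (a, b))) ∨ ∃ a : Fin 4, z = Sum.inr (2, (a, !b)) then 1 else 0 := by
  obtain ⟨G₁, G₂, hd, rfl, h₁, h₂⟩ := hG.exists_split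
  rw [Finset.filter_union, Finset.card_union_of_disjoint (Finset.disjoint_filter_filter hd), h₁.count_eq, h₂.count_eq]
  by_cases hz1 : ∃ a : Fin 4, z = Sum.inr (1, (a, b))
  · have hz2 : ¬ ∃ a : Fin 4, z = Sum.inr (2, (a, !b)) := fun ⟨a, ha⟩ => by
      obtain ⟨a', ha'⟩ := hz1; rw [ha'] at ha; simp at ha
    rw [if_pos hz1, if_neg hz2, if_pos (Or.inl hz1)]
  · by_cases hz2 : ∃ a : Fin 4, z = Sum.inr (2, (a, !b))
    · rw [if_neg hz1, if_pos hz2, if_pos (Or.inr hz2)]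
    · rw [if_neg hz1, if_neg hz2, if_neg (fun h => h.elim hz1 hz2)]

/-! ### The parts are balanced -/

/-- **A sixfold part of a `(1,3)`-slot (`m ≠ 0`) is balanced** (three of its six points lie in each `ρ_r⁻¹(type)`).
[cite: MoonenZarhin1995Duke, Thm. 2.4] -/
theorem IsSixfoldPart.modelBalancedP {m : Fin 3} (hm : m ≠ 0) {b : Bool} {G : Finset α} (hG : IsSixfoldPart v m b G) :
    ModelBalancedP v G := by
  classical
  intro r
  rw [card_filter_mem_eq_sum₃, card_eq_sum₃ v G]
  simp only [hG.count_eq]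
  have key : ∀ (m : Fin 3) (b : Bool) (r : Fin 12), m ≠ 0 →
      2 * ∑ z ∈ phiP r, (if z = Sum.inl b then 2 else if ∃ a : Fin 4, z = Sum.inr (m, (a, b)) then 1 else 0) =
        ∑ z : Pt₃, (if z = Sum.inl b then 2 else if ∃ a : Fin 4, z = Sum.inr (m, (a, b)) then 1 else 0) := by
    unfold phiP inPhiP signTabP sixTab
    decide +kernel
  exact key m b r hm

/-- **An eightfold part is balanced** (four of its eight points lie in each `ρ_r⁻¹(type)`: one `(1,a,b)` and three `(2,a,¬b)`
or three and one, according to the sign of `ρ_r`). [cite: MoonenZarhin1995Duke, Thm. 2.4] -/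
theorem IsEightfoldPart.modelBalancedP {b : Bool} {G : Finset α} (hG : IsEightfoldPart v b G) : ModelBalancedP v G := by
  classical
  intro r
  rw [card_filter_mem_eq_sum₃, card_eq_sum₃ v G]
  simp only [hG.count_eq]
  have key : ∀ (b : Bool) (r : Fin 12),
      2 * ∑ z ∈ phiP r, (if (∃ a : Fin 4, z = Sum.inr (1, (a, b))) ∨ ∃ a : Fin 4, z = Sum.inr (2, (a, !b)) then 1 else 0) =
        ∑ z : Pt₃, (if (∃ a : Fin 4, z = Sum.inr (1, (a, b))) ∨ ∃ a : Fin 4, z = Sum.inr (2, (a, !b)) then 1 else 0) := by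
    unfold phiP inPhiP signTabP sixTab
    decide +kernel
  exact key b r

/-- **A pair part is balanced** in this model. [cite: Gordon1999HodgeAVSurvey, 9.2.2] -/
theorem modelBalancedP_of_isPairPart₃ [DecidableEq α] {G : Finset α} (hG : IsPairPart₃ v G) : ModelBalancedP v G := by
  obtain ⟨y, hy⟩ := hG.count_eq
  intro r
  rw [card_filter_mem_eq_sum₃, card_eq_sum₃ v G]
  simp only [hy]
  have key : ∀ (y : Pt₃) (r : Fin 12), 2 * ∑ z ∈ phiP r, (if z = y ∨ z = cj₃ y then 1 else 0) =
      ∑ z : Pt₃, (if z = y ∨ z = cj₃ y then 1 else 0) := by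
    unfold phiP inPhiP signTabP sixTab
    decide +kernel
  exact key y r

/-- **A Weil part of the `(2,2)`-slot `0` is balanced** in this model. [cite: MoonenZarhin1995Duke, Thm. 2.4] -/
theorem modelBalancedP_of_isWeil₃Part {b : Bool} {G : Finset α} (hG : IsWeil₃Part v 0 b G) : ModelBalancedP v G := by
  classical
  intro r
  rw [card_filter_mem_eq_sum₃, card_eq_sum₃ v G]
  simp only [hG.count_eq]
  have key : ∀ (b : Bool) (r : Fin 12),
      2 * ∑ z ∈ phiP r, (if ∃ a : Fin 4, z = Sum.inr (0, (a, b)) then 1 else 0) =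
        ∑ z : Pt₃, (if ∃ a : Fin 4, z = Sum.inr (0, (a, b)) then 1 else 0) := by
    unfold phiP inPhiP signTabP sixTab
    decide +kernel
  exact key b r

/-! ### Elementary properties of the parts -/

/-- In a sixfold part the two points over the curve label are distinct elements (two different copies of `E`). [folklore] -/
theorem IsSixfoldPart.exists_pair [DecidableEq α] {m : Fin 3} {b : Bool} {G : Finset α} (hG : IsSixfoldPart v m b G) :
    ∃ x₁ ∈ G, ∃ x₂ ∈ G, x₁ ≠ x₂ ∧ v x₁ = Sum.inl b ∧ v x₂ = Sum.inl b := by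
  obtain ⟨x₁, x₂, hne, h12⟩ := Finset.card_eq_two.1 hG.2.1
  have h1 : x₁ ∈ G.filter fun x => v x = Sum.inl b := by rw [h12]; simp
  have h2 : x₂ ∈ G.filter fun x => v x = Sum.inl b := by rw [h12]; simp
  exact ⟨x₁, (Finset.mem_filter.1 h1).1, x₂, (Finset.mem_filter.1 h2).1, hne, (Finset.mem_filter.1 h1).2,
    (Finset.mem_filter.1 h2).2⟩

/-- Every point of a sixfold part lies over `inl b` or over a label `(m, a, b)`. [folklore] -/
theorem IsSixfoldPart.mem_cases {m : Fin 3} {b : Bool} {G : Finset α} (hG : IsSixfoldPart v m b G) {x : α} (hx : x ∈ G) :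
    v x = Sum.inl b ∨ ∃ a : Fin 4, v x = Sum.inr (m, (a, b)) := by
  classical
  have hpos : 0 < (G.filter fun x' => v x' = v x).card := Finset.card_pos.2 ⟨x, Finset.mem_filter.2 ⟨hx, rfl⟩⟩
  rw [hG.count_eq] at hpos
  by_contra h
  push Not at h
  rw [if_neg h.1, if_neg (fun ⟨a, ha⟩ => h.2 a ha)] at hpos
  exact lt_irrefl 0 hpos

/-- In a sixfold part, two points over the same fourfold label coincide. [folklore] -/
theorem IsSixfoldPart.eq_of_inr {m : Fin 3} {b : Bool} {G : Finset α} (hG : IsSixfoldPart v m b G) {x x' : α} (hx : x ∈ G)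
    (hx' : x' ∈ G) {q : Fin 3 × (Fin 4 × Bool)} (hq : v x = Sum.inr q) (hq' : v x' = Sum.inr q) : x = x' := by
  classical
  obtain ⟨a, ha⟩ : ∃ a : Fin 4, v x = Sum.inr (m, (a, b)) := by
    rcases hG.mem_cases hx with h | h
    · rw [hq] at h; exact absurd h Sum.inr_ne_inl
    · exact h
  have hqa : q = (m, (a, b)) := by rw [hq] at ha; exact Sum.inr.inj ha
  subst hqa
  obtain ⟨z, hz⟩ := Finset.card_eq_one.1 (hG.2.2 a)
  have hxz : x ∈ G.filter fun x => v x = Sum.inr (m, (a, b)) := Finset.mem_filter.2 ⟨hx, hq⟩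
  have hx'z : x' ∈ G.filter fun x => v x = Sum.inr (m, (a, b)) := Finset.mem_filter.2 ⟨hx', hq'⟩
  rw [hz, Finset.mem_singleton] at hxz hx'z
  rw [hxz, hx'z]

/-- A sixfold part is non-empty. [folklore] -/
theorem IsSixfoldPart.nonempty {m : Fin 3} {b : Bool} {G : Finset α} (hG : IsSixfoldPart v m b G) : G.Nonempty := by
  rw [← Finset.card_pos, hG.1]; norm_num

/-- Every point of an eightfold part lies over a label `(1, a, b)` or `(2, a, ¬b)`. [folklore] -/
theorem IsEightfoldPart.mem_cases {b : Bool} {G : Finset α} (hG : IsEightfoldPart v b G) {x : α} (hx : x ∈ G) :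
    (∃ a : Fin 4, v x = Sum.inr (1, (a, b))) ∨ ∃ a : Fin 4, v x = Sum.inr (2, (a, !b)) := by
  classical
  have hpos : 0 < (G.filter fun x' => v x' = v x).card := Finset.card_pos.2 ⟨x, Finset.mem_filter.2 ⟨hx, rfl⟩⟩
  rw [hG.count_eq] at hpos
  by_contra h
  rw [if_neg h] at hpos
  exact lt_irrefl 0 hpos

/-- The model map is injective on an eightfold part (one point over each of its eight labels). [folklore] -/
theorem IsEightfoldPart.injOn {b : Bool} {G : Finset α} (hG : IsEightfoldPart v b G) : Set.InjOn v ↑G := by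
  classical
  intro x hx x' hx' h
  have hle : (G.filter fun y => v y = v x).card ≤ 1 := by
    rw [hG.count_eq]; split_ifs <;> omega
  exact Finset.card_le_one.1 hle x (Finset.mem_filter.2 ⟨hx, rfl⟩) x' (Finset.mem_filter.2 ⟨hx', h.symm⟩)

/-- An eightfold part is non-empty. [folklore] -/
theorem IsEightfoldPart.nonempty {b : Bool} {G : Finset α} (hG : IsEightfoldPart v b G) : G.Nonempty := by
  rw [← Finset.card_pos, hG.1]; norm_num

/-! ### Extraction and induction -/

/-- A sixfold part inside `T` from the counts: two points over `inl b` and one over each `(m, a, b)`. [folklore] -/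
theorem exists_sixfoldPart_of_counts [DecidableEq α] {T : Finset α} (m : Fin 3) (b : Bool)
    (hE : 2 ≤ (T.filter fun x => v x = Sum.inl b).card)
    (hB : ∀ a : Fin 4, 0 < (T.filter fun x => v x = Sum.inr (m, (a, b))).card) : ∃ G ⊆ T, IsSixfoldPart v m b G := by
  obtain ⟨C, hCT, hC2⟩ := Finset.exists_subset_card_eq hE
  obtain ⟨W, hWT, hW⟩ := exists_weil₃Part_of_counts (v := v) (T := T) m b hB
  have hCW : Disjoint C W := by
    rw [Finset.disjoint_left]
    intro x hxC hxW
    obtain ⟨a, ha⟩ := hW.exists_eq_inr hxW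
    have hx := (Finset.mem_filter.1 (hCT hxC)).2
    rw [hx] at ha
    exact Sum.inl_ne_inr ha
  refine ⟨C ∪ W, Finset.union_subset (fun x hx => Finset.mem_of_mem_filter _ (hCT hx)) hWT, ?_, ?_, fun a => ?_⟩
  · rw [Finset.card_union_of_disjoint hCW, hC2, hW.1]
  · rw [Finset.filter_union, Finset.filter_true_of_mem fun x hx => (Finset.mem_filter.1 (hCT hx)).2,
      Finset.filter_false_of_mem fun x hx => ?_, Finset.union_empty, hC2]
    obtain ⟨a, ha⟩ := hW.exists_eq_inr hx
    rw [ha]; exact Sum.inr_ne_inl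
  · rw [Finset.filter_union, Finset.filter_false_of_mem fun x hx => ?_, Finset.empty_union, hW.2 a]
    rw [(Finset.mem_filter.1 (hCT hx)).2]; exact Sum.inl_ne_inr

/-- An eightfold part inside `T` from the counts: one point over each `(1, a, b)` and each `(2, a, ¬b)`. [folklore] -/
theorem exists_eightfoldPart_of_counts [DecidableEq α] {T : Finset α} (b : Bool)
    (h1 : ∀ a : Fin 4, 0 < (T.filter fun x => v x = Sum.inr (1, (a, b))).card)
    (h2 : ∀ a : Fin 4, 0 < (T.filter fun x => v x = Sum.inr (2, (a, !b))).card) : ∃ G ⊆ T, IsEightfoldPart v b G := by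
  obtain ⟨W₁, hW₁T, hW₁⟩ := exists_weil₃Part_of_counts (v := v) (T := T) 1 b h1
  obtain ⟨W₂, hW₂T, hW₂⟩ := exists_weil₃Part_of_counts (v := v) (T := T) 2 (!b) h2
  have hW : Disjoint W₁ W₂ := by
    rw [Finset.disjoint_left]
    intro x hx1 hx2
    obtain ⟨a, ha⟩ := hW₁.exists_eq_inr hx1
    obtain ⟨a', ha'⟩ := hW₂.exists_eq_inr hx2
    have := ha.symm.trans ha'
    simp at this
  refine ⟨W₁ ∪ W₂, Finset.union_subset hW₁T hW₂T, ?_, fun a => ?_, fun a => ?_⟩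
  · rw [Finset.card_union_of_disjoint hW, hW₁.1, hW₂.1]
  · rw [Finset.filter_union, Finset.filter_false_of_mem (s := W₂) fun x hx => ?_, Finset.union_empty, hW₁.2 a]
    obtain ⟨a', ha'⟩ := hW₂.exists_eq_inr hx
    rw [ha']; simp
  · rw [Finset.filter_union, Finset.filter_false_of_mem (s := W₁) fun x hx => ?_, Finset.empty_union, hW₂.2 a]
    obtain ⟨a', ha'⟩ := hW₁.exists_eq_inr hx
    rw [ha']; simp

/-- **EXTRACTION.**  A non-empty balanced configuration contains a pair part, a Weil part of slot `0`, a sixfold part of slot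
`1` or `2`, or an eightfold part (proof in the module docstring, from the defect law).
[cite: Milne2020HodgeClassesAV, 1.2 (a) and Thm. 1] [cite: Dodson1984, §3.3.2 Theorem] -/
theorem exists_part_of_modelBalancedP [DecidableEq α] {T : Finset α} (hT : ModelBalancedP v T) (hne : T.Nonempty) :
    ∃ G ⊆ T, IsPairPart₃ v G ∨ (∃ b, IsWeil₃Part v 0 b G) ∨ (∃ m b, m ≠ 0 ∧ IsSixfoldPart v m b G) ∨
      ∃ b, IsEightfoldPart v b G := by
  obtain ⟨t, ht, hE⟩ := exists_defectP_of_modelBalancedP hT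
  -- a Weil part of slot `0`
  by_cases h0 : t 0 ≠ 0
  · rcases lt_or_gt_of_ne h0 with hneg | hpos
    · obtain ⟨G, hG, hW⟩ := exists_weil₃Part_of_counts (v := v) (T := T) 0 false fun a => by have h := ht 0 a; omega
      exact ⟨G, hG, Or.inr (Or.inl ⟨false, hW⟩)⟩
    · obtain ⟨G, hG, hW⟩ := exists_weil₃Part_of_counts (v := v) (T := T) 0 true fun a => by have h := ht 0 a; omega
      exact ⟨G, hG, Or.inr (Or.inl ⟨true, hW⟩)⟩
  push Not at h0
  -- the eightfold case: `t_1`, `t_2` of strictly opposite signs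
  by_cases h8 : 0 < t 1 ∧ t 2 < 0
  · obtain ⟨G, hG, h⟩ := exists_eightfoldPart_of_counts (v := v) (T := T) true
      (fun a => by have h := ht 1 a; omega) (fun a => by have h := ht 2 a; rw [Bool.not_true]; omega)
    exact ⟨G, hG, Or.inr (Or.inr (Or.inr ⟨true, h⟩))⟩
  by_cases h8' : t 1 < 0 ∧ 0 < t 2
  · obtain ⟨G, hG, h⟩ := exists_eightfoldPart_of_counts (v := v) (T := T) false
      (fun a => by have h := ht 1 a; omega) (fun a => by have h := ht 2 a; rw [Bool.not_false]; omega)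
    exact ⟨G, hG, Or.inr (Or.inr (Or.inr ⟨false, h⟩))⟩
  -- a sixfold part of slot `1`
  by_cases h1 : t 1 ≠ 0
  · rcases lt_or_gt_of_ne h1 with hneg | hpos
    · have h2 : t 2 ≤ 0 := by by_contra h; exact h8' ⟨hneg, by omega⟩
      obtain ⟨G, hG, hS⟩ := exists_sixfoldPart_of_counts (v := v) (T := T) 1 false (by omega) fun a => by
        have h := ht 1 a; omega
      exact ⟨G, hG, Or.inr (Or.inr (Or.inl ⟨1, false, by decide, hS⟩))⟩
    · have h2 : 0 ≤ t 2 := by by_contra h; exact h8 ⟨hpos, by omega⟩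
      obtain ⟨G, hG, hS⟩ := exists_sixfoldPart_of_counts (v := v) (T := T) 1 true (by omega) fun a => by
        have h := ht 1 a; omega
      exact ⟨G, hG, Or.inr (Or.inr (Or.inl ⟨1, true, by decide, hS⟩))⟩
  push Not at h1
  -- a sixfold part of slot `2`
  by_cases h2 : t 2 ≠ 0
  · rcases lt_or_gt_of_ne h2 with hneg | hpos
    · obtain ⟨G, hG, hS⟩ := exists_sixfoldPart_of_counts (v := v) (T := T) 2 false (by omega) fun a => by
        have h := ht 2 a; omega
      exact ⟨G, hG, Or.inr (Or.inr (Or.inl ⟨2, false, by decide, hS⟩))⟩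
    · obtain ⟨G, hG, hS⟩ := exists_sixfoldPart_of_counts (v := v) (T := T) 2 true (by omega) fun a => by
        have h := ht 2 a; omega
      exact ⟨G, hG, Or.inr (Or.inr (Or.inl ⟨2, true, by decide, hS⟩))⟩
  push Not at h2
  -- all `t_m = 0`: conjugation-invariant counts, a pair part
  have hz : ∀ (m : Fin 3) (a : Fin 4), (T.filter fun x => v x = Sum.inr (m, (a, true))).card =
      (T.filter fun x => v x = Sum.inr (m, (a, false))).card := by
    intro m a
    have htm : t m = 0 := by
      fin_cases m
      exacts [h0, h1, h2]
    have h := ht m a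
    omega
  have hEE : (T.filter fun x => v x = Sum.inl true).card = (T.filter fun x => v x = Sum.inl false).card := by omega
  obtain ⟨x, hx⟩ := hne
  have hNx : 0 < (T.filter fun x' => v x' = v x).card := Finset.card_pos.2 ⟨x, Finset.mem_filter.2 ⟨hx, rfl⟩⟩
  have hNcx : 0 < (T.filter fun x' => v x' = cj₃ (v x)).card := by
    rcases hvx : v x with s | ⟨m, ⟨a, s⟩⟩ <;> rw [hvx] at hNx
    · cases s
      · rw [cj₃_inl, Bool.not_false]; omega
      · rw [cj₃_inl, Bool.not_true]; omega
    · have h := hz m a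
      cases s
      · rw [cj₃_inr, Bool.not_false]; omega
      · rw [cj₃_inr, Bool.not_true]; omega
  obtain ⟨G, hG, hP⟩ := exists_pairPart₃_of_counts (y := v x) hNx hNcx
  exact ⟨G, hG, Or.inl hP⟩

/-- **INDUCTION PRINCIPLE FOR BALANCED CONFIGURATIONS (any number of copies of `E, B, B'₁, B'₂`).**  If `motive` holds for `∅` and
passes from `R` to `G ∪ R` for `G` disjoint from `R` a pair part, a Weil part of slot `0`, a sixfold part of a slot `m ≠ 0`,
or an eightfold part, then `motive` holds for every balanced configuration.
[cite: Milne2020HodgeClassesAV, 1.2 (a) and Thm. 1] [cite: GaoUllmo2025, Thm 3.1] -/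
theorem modelBalancedP_induction [DecidableEq α] {motive : Finset α → Prop} (h0 : motive ∅)
    (hpair : ∀ G R : Finset α, Disjoint G R → IsPairPart₃ v G → motive R → motive (G ∪ R))
    (hweil : ∀ (G R : Finset α) (b : Bool), Disjoint G R → IsWeil₃Part v 0 b G → motive R → motive (G ∪ R))
    (hsix : ∀ (G R : Finset α) (m : Fin 3) (b : Bool), m ≠ 0 → Disjoint G R → IsSixfoldPart v m b G → motive R →
      motive (G ∪ R))
    (height : ∀ (G R : Finset α) (b : Bool), Disjoint G R → IsEightfoldPart v b G → motive R → motive (G ∪ R))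
    {T : Finset α} (hT : ModelBalancedP v T) : motive T := by
  induction T using Finset.strongInduction with
  | H T ih =>
    by_cases hTe : T = ∅
    · subst hTe; exact h0
    obtain ⟨G, hGT, hG⟩ := exists_part_of_modelBalancedP hT (Finset.nonempty_iff_ne_empty.2 hTe)
    rcases hG with hP | ⟨b, hW⟩ | ⟨m, b, hm, hS⟩ | ⟨b, h8⟩
    · have hR : ModelBalancedP v (T \ G) := hT.sdiff (modelBalancedP_of_isPairPart₃ hP) hGT
      have hlt : T \ G ⊂ T := Finset.sdiff_ssubset hGT hP.nonempty
      have h := hpair G (T \ G) Finset.disjoint_sdiff hP (ih _ hlt hR)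
      rwa [Finset.union_sdiff_of_subset hGT] at h
    · have hR : ModelBalancedP v (T \ G) := hT.sdiff (modelBalancedP_of_isWeil₃Part hW) hGT
      have hlt : T \ G ⊂ T := Finset.sdiff_ssubset hGT hW.nonempty
      have h := hweil G (T \ G) b Finset.disjoint_sdiff hW (ih _ hlt hR)
      rwa [Finset.union_sdiff_of_subset hGT] at h
    · have hR : ModelBalancedP v (T \ G) := hT.sdiff (hS.modelBalancedP hm) hGT
      have hlt : T \ G ⊂ T := Finset.sdiff_ssubset hGT hS.nonempty
      have h := hsix G (T \ G) m b hm Finset.disjoint_sdiff hS (ih _ hlt hR)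
      rwa [Finset.union_sdiff_of_subset hGT] at h
    · have hR : ModelBalancedP v (T \ G) := hT.sdiff h8.modelBalancedP hGT
      have hlt : T \ G ⊂ T := Finset.sdiff_ssubset hGT h8.nonempty
      have h := height G (T \ G) b Finset.disjoint_sdiff h8 (ih _ hlt hR)
      rwa [Finset.union_sdiff_of_subset hGT] at h

end Summit.HodgeConjecture.CorCM.Census.OcticWeil13Pair
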